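import Literature.NumberTheory.ComplexMultiplication.KottwitzSignatureReflexFieldDegree
import Literature.NumberTheory.ComplexMultiplication.CMTypeSubfieldTracesReflexFieldRationalOrCM
import HarnessLib

/-!
# The number of `k₀`-signatures in a Galois class of CM types is the degree `[ℚ(tr_Φ(k₀)) : ℚ]`;
# `τ(ℚ(tr_Φ(k₀))) = ℚ(tr_{τΦ}(k₀))`; over an imaginary quadratic `k₀` it is `1` (balanced) or `2` (Dodson)

Layer `Literature/NumberTheory/ComplexMultiplication`, namespace `Literature.NumberTheory.ComplexMultiplication` (lane
`lit-hodgefound`, Track 2 foundations, Layer A3; seat `lit-hodgefound-p11`, generation 29, row g29-#6).  Sequel of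
`KottwitzSignatureReflexFieldDegree` (g29-#5: `#{τ·r ∣ τ ∈ Aut(ℂ)} = [E_r : ℚ]`, `τ(E_r) = E_{τ·r}`),
`CMTypeSubfieldTracesReflexField` (g28-#5: `ℚ(tr_Φ(k₀)) = E_m` for the `k₀`-signature
`m_ψ = #{φ ∈ Φ ∣ φ|_{k₀} = ψ}`), `CMTypeSubfieldTracesReflexFieldRationalOrCM` (g29-#3: `ℚ(tr_Φ(k₀)) = ℚ ⟺ Φ` balanced over
`k₀`; imaginary quadratic `k₀`) and `CMTypeSignatureGaloisClasses` (g26-#2: `m_{τΦ}(ψ) = m_Φ(τ⁻¹ψ)`, Dodson's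
«`G`-orbit of `f` is `G₀*(f) ∪ G₀*(ρf)`»).  THEOREMS ONLY (D-0026): no definition, no named fact, no instance; the
`k₀`-signature is WRITTEN OUT as `fun ψ => {φ : K →+* ℂ | φ ∈ Φ.1 ∧ φ.comp (algebraMap k₀ K) = ψ}.ncard` and
`ℚ(tr_Φ(k₀))` as `IntermediateField.adjoin ℚ (Set.range fun a : k₀ => cmTypeTrace Φ (algebraMap k₀ K a))` (g28-#5's spelling).

THE PRINTS.  B. Dodson, *The structure of Galois groups of CM-fields*, Trans. AMS 283 (1984) [Dodson1984] §1.1 Remark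
(held `paper:doi-10-2307-1999987` p. 5): «Note that `[K′ : ℚ]` is also the order of the orbit of `Φ` under the `G`-action»
(the case `k₀ = K`, the tree's `natCard_galoisClass_eq_finrank_traceField`), and §3.1.1 Theorem, proof (p. 12): for an
imaginary quadratic subfield `D ⊂ K` «the `G`-orbit of `f` is `G₀*(f) ∪ G₀*(ρf)` […] the weight `w = weight(v)` is
constant for `v ∈ G₀*(f)`» — so the signatures `(a, n − a)` met in a Galois class are `f`'s and `ρf`'s: TWO unless
`a = n − a`.  R. E. Kottwitz [Kottwitz1992] §5 pp. 389–390: the reflex field `E` is «the field of definition of the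
isomorphism class of the complex representation `V₁` of `B`» — for `B = k₀` the class of `V₁` is the `k₀`-signature `m`, and
(J. S. Milne, K.-y. Shih in LNM 900 [Deligne1982HodgeCycles] V §1 p. 216, §4) a field of definition `E ⊂ ℂ` has `[E : ℚ]` =
the number of `Aut(ℂ)`-conjugates of the object.  G. Shimura [Shimura1998] §8.3 Prop. 28 (`[K* : ℚ] = [G : H*]`).
S. Kudla, M. Rapoport [KudlaRapoport2013] §4.4 («`E = ℚ` if `r = n − r`, and `E = k` otherwise»).  Galois theory:
J. S. Milne [MilneFT2022] Prop. 2.7, Cor. 3.4; Mathlib `AlgHom.fieldRange_of_normal` (a normal `k₀` has one image in `ℂ`).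

WHAT IS PROVED (`K` a number field, `k₀ : IntermediateField ℚ K`, `Φ : CMType K`; `m = m_Φ` its `k₀`-signature,
`E₀ = ℚ(tr_Φ(k₀))`; `[IsCMField K]` where `τΦ` is used).
§1 **`map_adjoin_cmTypeTrace_algebraMap`** (`τ(ℚ(tr_Φ(k₀))) = ℚ(tr_{τΦ}(k₀))`), `finrank_adjoin_cmTypeTrace_algebraMap_cmTypeSmul`
   / `…_eq_of_rel` (Galois-equivalent types: same degree), `adjoin_cmTypeTrace_algebraMap_cmTypeSmul_eq_bot_iff`,
   **`forall_two_mul_ncard_inter_fibre_cmTypeSmul_eq_iff`** (BALANCEDNESS OVER `k₀` IS A GALOIS-CLASS INVARIANT — Dodson's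
   constant weight, for every subfield `k₀`), `isCMField_adjoin_cmTypeTrace_algebraMap_cmTypeSmul_iff`.
§2 **`natCard_galoisClass_subfieldSignature_eq_finrank`** (`#{τ·m ∣ τ ∈ Aut(ℂ)} = [ℚ(tr_Φ(k₀)) : ℚ]`, any `K`),
   **`natCard_subfieldSignature_cmTypeSmul_eq_finrank`** / `natCard_subfieldSignature_of_rel_eq_finrank` (`K` CM: THE NUMBER
   OF `k₀`-SIGNATURES OF THE TYPES IN THE GALOIS CLASS OF `Φ` IS `[ℚ(tr_Φ(k₀)) : ℚ]`), `natCard_subfieldSignature_cmTypeSmul_dvd_natCard_galoisClass`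
   (it divides the size `[K* : ℚ]` of the class), `natCard_galoisClass_subfieldSignature_dvd_of_le` (tower `k₀ ≤ k₁`),
   `adjoin_cmTypeTrace_algebraMap_top` (`ℚ(tr_Φ(K)) = K*`) and `natCard_galoisClass_subfieldSignature_top` (`k₀ = K`: Dodson's
   Remark), `adjoin_cmTypeTrace_algebraMap_le_iSup_fieldRange` (`E₀ ⊆` the compositum of the `ψ(k₀)`),
   **`adjoin_cmTypeTrace_algebraMap_le_fieldRange_of_normal`** (`k₀/ℚ` normal ⟹ `E₀ ⊆ ψ(k₀)`) and
   `natCard_galoisClass_subfieldSignature_dvd_finrank_of_normal` (then `#{τ·m} ∣ [k₀ : ℚ]`).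
§3 `k₀` imaginary quadratic: `natCard_galoisClass_subfieldSignature_le_two` («`G₀*(f) ∪ G₀*(ρf)`»: at most two signatures),
   **`natCard_galoisClass_subfieldSignature_eq_one_iff`** (`= 1 ⟺ m_{ψ₀} = m_{ψ̄₀}`, the balanced / Weil case),
   **`natCard_galoisClass_subfieldSignature_eq_two_iff`** (`= 2 ⟺ m_{ψ₀} ≠ m_{ψ̄₀}`), and for `K` CM the same for the
   signatures of the class (`natCard_subfieldSignature_cmTypeSmul_eq_one_iff`, `…_eq_two_iff`).

## References

* [Dodson1984] B. Dodson, *The structure of Galois groups of CM-fields*, Trans. AMS 283 (1984), §1.1 Remark (p. 5), §3.1.1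
  Theorem and proof (p. 12).
* [Kottwitz1992] R. E. Kottwitz, *Points on some Shimura varieties over finite fields*, JAMS 5 (1992), §5 pp. 389–390.
* [Deligne1982HodgeCycles] P. Deligne, J. S. Milne, A. Ogus, K.-y. Shih, LNM 900 (1982): J. S. Milne, K.-y. Shih, *Conjugates of
  Shimura varieties*, V §1 p. 216, §4.
* [Shimura1998] G. Shimura, *Abelian Varieties with Complex Multiplication and Modular Functions* (1998), §8.3 Prop. 28.
* [KudlaRapoport2013] S. Kudla, M. Rapoport, *Special cycles on unitary Shimura varieties II*, J. reine angew. Math. 697 (2014);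
  arXiv:0912.3758 §4.1 footnote, §4.4.
* [MilneFT2022] J. S. Milne, *Fields and Galois Theory* (2022), Prop. 2.7, Cor. 3.4, Thm. 3.16.

## Provenance

Lane `lit-hodgefound` (HOME `run/shared/lean/pub/lit-hodgefound/`), prover seat `lit-hodgefound-p11` (gen 29), self-proposed row
g29-#6 (lane INBOX claim 2026-08-27), sequel of g29-#5 / g29-#3 / g28-#5 / g26-#2.
-/

set_option autoImplicit false

noncomputable section

open scoped Classical Pointwise
open NumberField Module IntermediateField

namespace Literature.NumberTheory.ComplexMultiplication

open Literature.AlgebraicGeometry.Motives (CMType)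
open Literature.AlgebraicGeometry.Motives.HodgeStructure (cmTypeSmul cmTypeSmul_val)

variable {K : Type} [Field K] [NumberField K] (k₀ : IntermediateField ℚ K) (Φ : CMType K)

/-! ## §0 Preliminaries -/

section Prelim

/-- `[A : ℚ] ∣ [B : ℚ]` for nested subfields `A ≤ B` of `ℂ`, `B` a number field. [folklore] -/
private theorem finrank_dvd_of_le_sd {A B : IntermediateField ℚ ℂ} (h : A ≤ B) : finrank ℚ A ∣ finrank ℚ B :=
  Dvd.intro _ (IntermediateField.finrank_bot_mul_relfinrank h)

/-- `[ψ(k₀) : ℚ] = [k₀ : ℚ]`. [folklore] -/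
private theorem finrank_fieldRange_sd {E : Type} [Field E] [NumberField E] (s : E →+* ℂ) :
    finrank ℚ s.toRatAlgHom.fieldRange = finrank ℚ E := by
  rw [← IntermediateField.finrank_eq_finrank_subalgebra, AlgHom.fieldRange_toSubalgebra]
  exact (AlgEquiv.ofInjectiveField s.toRatAlgHom).toLinearEquiv.finrank_eq.symm

/-- Two embeddings of a NORMAL extension `E/ℚ` into `ℂ` have the same image (Mathlib `AlgHom.fieldRange_of_normal`, which is
stated for intermediate fields; same argument as the tree's `SorensenPatching.fieldRange_eq_fieldRange_of_normal`, kept local to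
spare the import). [folklore] -/
private theorem fieldRange_eq_fieldRange_of_normal_sd {F E L : Type} [Field F] [Field E] [Field L] [Algebra F E]
    [Algebra F L] [Normal F E] (f g : E →ₐ[F] L) : f.fieldRange = g.fieldRange := by
  have key : ∀ f g : E →ₐ[F] L, g.fieldRange ≤ f.fieldRange := by
    intro f g
    haveI : Normal F f.fieldRange := Normal.of_algEquiv f.equivFieldRange
    have h := AlgHom.fieldRange_of_normal (g.comp f.equivFieldRange.symm.toAlgHom)
    intro z hz
    obtain ⟨x, rfl⟩ := AlgHom.mem_fieldRange.1 hz
    rw [← h]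
    exact ⟨f.equivFieldRange x, by simp⟩
  exact le_antisymm (key g f) (key f g)

end Prelim

/-! ## §1 `τ(ℚ(tr_Φ(k₀))) = ℚ(tr_{τΦ}(k₀))`: Galois-equivalent types have conjugate subfield trace fields -/

section Translate

variable [IsCMField K]

/-- **`τ(ℚ(tr_Φ(k₀))) = ℚ(tr_{τΦ}(k₀))`** (`tr_{τΦ} = τ ∘ tr_Φ`): the reflex field of the `k₀`-signature of the conjugate type is
the conjugate field (Milne–Shih: `E(τG, τX) = τE(G, X)`). [cite: Deligne1982HodgeCycles, V §4 (Milne–Shih)]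
[cite: Shimura1998, §8.3 Prop. 28] [cite: Kottwitz1992, §5 pp. 389–390] -/
theorem map_adjoin_cmTypeTrace_algebraMap (τ : ℂ ≃+* ℂ) :
    (IntermediateField.adjoin ℚ (Set.range fun a : k₀ => cmTypeTrace Φ (algebraMap k₀ K a))).map (τ : ℂ →+* ℂ).toRatAlgHom =
      IntermediateField.adjoin ℚ (Set.range fun a : k₀ => cmTypeTrace (cmTypeSmul τ Φ) (algebraMap k₀ K a)) := by
  rw [IntermediateField.adjoin_map, ← Set.range_comp]
  have h : ((τ : ℂ →+* ℂ).toRatAlgHom ∘ fun a : k₀ => cmTypeTrace Φ (algebraMap k₀ K a)) =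
      fun a : k₀ => cmTypeTrace (cmTypeSmul τ Φ) (algebraMap k₀ K a) :=
    funext fun a => (cmTypeTrace_cmTypeSmul τ Φ _).symm
  rw [h]

/-- `[ℚ(tr_{τΦ}(k₀)) : ℚ] = [ℚ(tr_Φ(k₀)) : ℚ]`. [cite: Shimura1998, §8.3 Prop. 28] [cite: Dodson1984, §3.1.1 Theorem (proof, p. 12)] -/
theorem finrank_adjoin_cmTypeTrace_algebraMap_cmTypeSmul (τ : ℂ ≃+* ℂ) :
    finrank ℚ (IntermediateField.adjoin ℚ (Set.range fun a : k₀ => cmTypeTrace (cmTypeSmul τ Φ) (algebraMap k₀ K a))) =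
      finrank ℚ (IntermediateField.adjoin ℚ (Set.range fun a : k₀ => cmTypeTrace Φ (algebraMap k₀ K a))) := by
  rw [← map_adjoin_cmTypeTrace_algebraMap]
  exact (IntermediateField.equivMap _ _).toLinearEquiv.finrank_eq.symm

/-- Galois-equivalent CM types have subfield trace fields `ℚ(tr(k₀))` of the same degree, for every `k₀ ⊆ K`.
[cite: Dodson1984, §3.1.1 Theorem (proof, p. 12)] [cite: Shimura1998, §8.3 Prop. 28] -/
theorem finrank_adjoin_cmTypeTrace_algebraMap_eq_of_rel {Φ Ψ : CMType K} (h : (cmTypeGaloisSetoid K).r Φ Ψ) :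
    finrank ℚ (IntermediateField.adjoin ℚ (Set.range fun a : k₀ => cmTypeTrace Ψ (algebraMap k₀ K a))) =
      finrank ℚ (IntermediateField.adjoin ℚ (Set.range fun a : k₀ => cmTypeTrace Φ (algebraMap k₀ K a))) := by
  obtain ⟨τ, rfl⟩ := h
  exact finrank_adjoin_cmTypeTrace_algebraMap_cmTypeSmul k₀ Φ τ

/-- `ℚ(tr_{τΦ}(k₀)) = ℚ ⟺ ℚ(tr_Φ(k₀)) = ℚ`. [cite: Dodson1984, §3.1.1 Theorem (proof, p. 12)] [cite: KudlaRapoport2013, §4.4] -/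
theorem adjoin_cmTypeTrace_algebraMap_cmTypeSmul_eq_bot_iff (τ : ℂ ≃+* ℂ) :
    IntermediateField.adjoin ℚ (Set.range fun a : k₀ => cmTypeTrace (cmTypeSmul τ Φ) (algebraMap k₀ K a)) = ⊥ ↔
      IntermediateField.adjoin ℚ (Set.range fun a : k₀ => cmTypeTrace Φ (algebraMap k₀ K a)) = ⊥ := by
  rw [← IntermediateField.finrank_eq_one_iff, ← IntermediateField.finrank_eq_one_iff,
    finrank_adjoin_cmTypeTrace_algebraMap_cmTypeSmul]

/-- **BALANCEDNESS OVER `k₀` IS A GALOIS-CLASS INVARIANT**: `τΦ` is balanced over `k₀` (`2 m_ψ = [K : k₀]` for all `ψ`) iff `Φ`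
is — Dodson's «the weight is constant on the orbit», for an arbitrary subfield `k₀` (both say `ℚ(tr(k₀)) = ℚ`, g29-#3).
[cite: Dodson1984, §3.1.1 Theorem (proof, p. 12)] [cite: Kottwitz1992, §5 pp. 389–390] -/
theorem forall_two_mul_ncard_inter_fibre_cmTypeSmul_eq_iff (τ : ℂ ≃+* ℂ) :
    (∀ ψ : k₀ →+* ℂ, 2 * {φ : K →+* ℂ | φ ∈ (cmTypeSmul τ Φ).1 ∧ φ.comp (algebraMap k₀ K) = ψ}.ncard = finrank k₀ K) ↔
      ∀ ψ : k₀ →+* ℂ, 2 * {φ : K →+* ℂ | φ ∈ Φ.1 ∧ φ.comp (algebraMap k₀ K) = ψ}.ncard = finrank k₀ K := by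
  rw [← adjoin_cmTypeTrace_algebraMap_eq_bot_iff, ← adjoin_cmTypeTrace_algebraMap_eq_bot_iff,
    adjoin_cmTypeTrace_algebraMap_cmTypeSmul_eq_bot_iff]

/-- `ℚ(tr_{τΦ}(k₀))` is a CM field iff `ℚ(tr_Φ(k₀))` is. [cite: Dodson1984, §3.1.1 Theorem (proof, p. 12)]
[cite: Shimura1998, §18.2 Lemma (iv)] -/
theorem isCMField_adjoin_cmTypeTrace_algebraMap_cmTypeSmul_iff (τ : ℂ ≃+* ℂ) :
    IsCMField (IntermediateField.adjoin ℚ (Set.range fun a : k₀ => cmTypeTrace (cmTypeSmul τ Φ) (algebraMap k₀ K a))) ↔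
      IsCMField (IntermediateField.adjoin ℚ (Set.range fun a : k₀ => cmTypeTrace Φ (algebraMap k₀ K a))) := by
  simp only [isCMField_adjoin_cmTypeTrace_algebraMap_iff, ne_eq, ← not_forall]
  exact not_congr (forall_two_mul_ncard_inter_fibre_cmTypeSmul_eq_iff k₀ Φ τ)

end Translate

/-! ## §2 `#{τ·m ∣ τ ∈ Aut(ℂ)} = [ℚ(tr_Φ(k₀)) : ℚ]`: the number of `k₀`-signatures in a Galois class -/

section Count

/-- **`#{τ·m ∣ τ ∈ Aut(ℂ)} = [ℚ(tr_Φ(k₀)) : ℚ]`** (`τ·m := m ∘ τ⁻¹`; any number field `K`): the degree of the field generated by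
the type traces of `k₀` is the number of `Aut(ℂ)`-conjugates of the `k₀`-signature `m` of `Φ` — g29-#5 for Kottwitz's `E_m =
ℚ(tr_Φ(k₀))` (g28-#5). [cite: Kottwitz1992, §5 pp. 389–390] [cite: Deligne1982HodgeCycles, V §1 p. 216 (Milne–Shih)]
[cite: MilneFT2022, Prop. 2.7] -/
theorem natCard_galoisClass_subfieldSignature_eq_finrank :
    Nat.card {m : (k₀ →+* ℂ) → ℕ // ∃ τ : ℂ ≃+* ℂ,
        m = fun ψ => {φ : K →+* ℂ | φ ∈ Φ.1 ∧ φ.comp (algebraMap k₀ K) = τ⁻¹ • ψ}.ncard} =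
      finrank ℚ (IntermediateField.adjoin ℚ (Set.range fun a : k₀ => cmTypeTrace Φ (algebraMap k₀ K a))) := by
  rw [adjoin_cmTypeTrace_algebraMap_eq_adjoin_sum]
  exact natCard_galoisClass_signature_eq_finrank_adjoin_sum
    (fun ψ : k₀ →+* ℂ => {φ : K →+* ℂ | φ ∈ Φ.1 ∧ φ.comp (algebraMap k₀ K) = ψ}.ncard)

/-- `ℚ(tr_Φ(k₀)) ⊆ ∏_ψ ψ(k₀)`: the subfield trace field lies in the compositum of the conjugates of `k₀` in `ℂ`.
[cite: Kottwitz1992, §5 p. 390] [cite: Shimura1998, §8.3 Prop. 28] -/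
theorem adjoin_cmTypeTrace_algebraMap_le_iSup_fieldRange :
    IntermediateField.adjoin ℚ (Set.range fun a : k₀ => cmTypeTrace Φ (algebraMap k₀ K a)) ≤
      ⨆ ψ : k₀ →+* ℂ, ψ.toRatAlgHom.fieldRange := by
  rw [adjoin_cmTypeTrace_algebraMap_eq_adjoin_sum]
  exact adjoin_sum_le_iSup_fieldRange
    (fun ψ : k₀ →+* ℂ => {φ : K →+* ℂ | φ ∈ Φ.1 ∧ φ.comp (algebraMap k₀ K) = ψ}.ncard)

/-- **`k₀/ℚ` NORMAL ⟹ `ℚ(tr_Φ(k₀)) ⊆ ψ(k₀)` for every `ψ`** (all the `ψ(k₀)` coincide). [cite: Shimura1998, §8.3 Prop. 28]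
[cite: Dodson1984, §3.1.1 Theorem (proof, p. 12: `Kᶜ = D K₀ᶜ`)] -/
theorem adjoin_cmTypeTrace_algebraMap_le_fieldRange_of_normal [Normal ℚ k₀] (ψ : k₀ →+* ℂ) :
    IntermediateField.adjoin ℚ (Set.range fun a : k₀ => cmTypeTrace Φ (algebraMap k₀ K a)) ≤ ψ.toRatAlgHom.fieldRange := by
  refine (adjoin_cmTypeTrace_algebraMap_le_iSup_fieldRange k₀ Φ).trans (iSup_le fun χ => ?_)
  rw [fieldRange_eq_fieldRange_of_normal_sd χ.toRatAlgHom ψ.toRatAlgHom]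

/-- `k₀/ℚ` normal ⟹ `[ℚ(tr_Φ(k₀)) : ℚ] ∣ [k₀ : ℚ]`. [cite: Shimura1998, §8.3 Prop. 28] [cite: MilneFT2022, Prop. 1.20] -/
theorem finrank_adjoin_cmTypeTrace_algebraMap_dvd_of_normal [Normal ℚ k₀] :
    finrank ℚ (IntermediateField.adjoin ℚ (Set.range fun a : k₀ => cmTypeTrace Φ (algebraMap k₀ K a))) ∣ finrank ℚ k₀ := by
  obtain ⟨ψ⟩ : Nonempty (k₀ →+* ℂ) := inferInstance
  rw [← finrank_fieldRange_sd ψ]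
  exact finrank_dvd_of_le_sd (adjoin_cmTypeTrace_algebraMap_le_fieldRange_of_normal k₀ Φ ψ)

/-- **`k₀/ℚ` normal ⟹ the number of conjugate `k₀`-signatures divides `[k₀ : ℚ]`.** [cite: Dodson1984, §3.1.1 Theorem (proof, p. 12)]
[cite: MilneFT2022, Prop. 2.7] -/
theorem natCard_galoisClass_subfieldSignature_dvd_finrank_of_normal [Normal ℚ k₀] :
    Nat.card {m : (k₀ →+* ℂ) → ℕ // ∃ τ : ℂ ≃+* ℂ,
        m = fun ψ => {φ : K →+* ℂ | φ ∈ Φ.1 ∧ φ.comp (algebraMap k₀ K) = τ⁻¹ • ψ}.ncard} ∣ finrank ℚ k₀ := by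
  rw [natCard_galoisClass_subfieldSignature_eq_finrank]
  exact finrank_adjoin_cmTypeTrace_algebraMap_dvd_of_normal k₀ Φ

/-- **Tower `k₀ ≤ k₁`: the number of conjugate `k₀`-signatures divides the number of conjugate `k₁`-signatures**
(`ℚ(tr_Φ(k₀)) ⊆ ℚ(tr_Φ(k₁))`). [cite: Shimura1998, §8.3 Prop. 28] [cite: MilneFT2022, Prop. 1.20] -/
theorem natCard_galoisClass_subfieldSignature_dvd_of_le {k₁ : IntermediateField ℚ K} (h : k₀ ≤ k₁) :
    Nat.card {m : (k₀ →+* ℂ) → ℕ // ∃ τ : ℂ ≃+* ℂ,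
        m = fun ψ => {φ : K →+* ℂ | φ ∈ Φ.1 ∧ φ.comp (algebraMap k₀ K) = τ⁻¹ • ψ}.ncard} ∣
      Nat.card {m : (k₁ →+* ℂ) → ℕ // ∃ τ : ℂ ≃+* ℂ,
        m = fun ψ => {φ : K →+* ℂ | φ ∈ Φ.1 ∧ φ.comp (algebraMap k₁ K) = τ⁻¹ • ψ}.ncard} := by
  rw [natCard_galoisClass_subfieldSignature_eq_finrank, natCard_galoisClass_subfieldSignature_eq_finrank]
  exact finrank_dvd_of_le_sd (adjoin_cmTypeTrace_algebraMap_mono k₀ Φ h)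

/-- **`ℚ(tr_Φ(K)) = K*`**: over `k₀ = K` the subfield trace field is the whole reflex field `ℚ(tr_Φ)`.
[cite: Shimura1998, §8.3 Prop. 28] -/
theorem adjoin_cmTypeTrace_algebraMap_top :
    IntermediateField.adjoin ℚ (Set.range fun a : (⊤ : IntermediateField ℚ K) =>
        cmTypeTrace Φ (algebraMap (⊤ : IntermediateField ℚ K) K a)) = traceField Φ := by
  have h : (Set.range fun a : (⊤ : IntermediateField ℚ K) => cmTypeTrace Φ (algebraMap (⊤ : IntermediateField ℚ K) K a)) =
      Set.range (cmTypeTrace Φ) := by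
    ext z
    constructor
    · rintro ⟨a, rfl⟩
      exact ⟨(a : K), rfl⟩
    · rintro ⟨x, rfl⟩
      exact ⟨⟨x, IntermediateField.mem_top⟩, rfl⟩
  rw [h]
  rfl

/-- **`k₀ = K`: `#{τ·m} = [K* : ℚ]`** — over `K` itself the signature is the type and one recovers Dodson's Remark «`[K′ : ℚ]` is
the order of the orbit of `Φ`» (the tree's `natCard_galoisClass_eq_finrank_traceField`). [cite: Dodson1984, §1.1 Remark (p. 5)]
[cite: Shimura1998, §8.3 Prop. 28] -/
theorem natCard_galoisClass_subfieldSignature_top :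
    Nat.card {m : ((⊤ : IntermediateField ℚ K) →+* ℂ) → ℕ // ∃ τ : ℂ ≃+* ℂ,
        m = fun ψ => {φ : K →+* ℂ | φ ∈ Φ.1 ∧ φ.comp (algebraMap (⊤ : IntermediateField ℚ K) K) = τ⁻¹ • ψ}.ncard} =
      finrank ℚ (traceField Φ) := by
  rw [natCard_galoisClass_subfieldSignature_eq_finrank, adjoin_cmTypeTrace_algebraMap_top]

variable [IsCMField K]

/-- **THE NUMBER OF `k₀`-SIGNATURES OF THE CONJUGATES `τΦ` IS `[ℚ(tr_Φ(k₀)) : ℚ]`** (`K` CM, so that `Aut(ℂ)` acts on the CM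
types of `K`; `m_{τΦ} = τ·m_Φ`, g26-#2). [cite: Dodson1984, §1.1 Remark (p. 5) and §3.1.1] [cite: Kottwitz1992, §5 pp. 389–390]
[cite: Deligne1982HodgeCycles, V §1 p. 216 (Milne–Shih)] -/
theorem natCard_subfieldSignature_cmTypeSmul_eq_finrank :
    Nat.card {m : (k₀ →+* ℂ) → ℕ // ∃ τ : ℂ ≃+* ℂ,
        m = fun ψ => {φ : K →+* ℂ | φ ∈ (cmTypeSmul τ Φ).1 ∧ φ.comp (algebraMap k₀ K) = ψ}.ncard} =
      finrank ℚ (IntermediateField.adjoin ℚ (Set.range fun a : k₀ => cmTypeTrace Φ (algebraMap k₀ K a))) := by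
  have h : ∀ τ : ℂ ≃+* ℂ, (fun ψ : k₀ →+* ℂ => {φ : K →+* ℂ | φ ∈ (cmTypeSmul τ Φ).1 ∧ φ.comp (algebraMap k₀ K) = ψ}.ncard) =
      fun ψ => {φ : K →+* ℂ | φ ∈ Φ.1 ∧ φ.comp (algebraMap k₀ K) = τ⁻¹ • ψ}.ncard :=
    fun τ => funext fun ψ => ncard_inter_fibre_cmTypeSmul k₀ τ Φ ψ
  simp only [h]
  exact natCard_galoisClass_subfieldSignature_eq_finrank k₀ Φ

/-- **THE NUMBER OF `k₀`-SIGNATURES MET IN THE GALOIS CLASS OF `Φ` IS `[ℚ(tr_Φ(k₀)) : ℚ]`** (the same statement over the class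
`{Ψ ∣ Ψ ~ Φ}` of `cmTypeGaloisSetoid`). [cite: Dodson1984, §1.1 Remark (p. 5) and §3.1.1 Theorem (proof, p. 12)]
[cite: Kottwitz1992, §5 pp. 389–390] -/
theorem natCard_subfieldSignature_of_rel_eq_finrank :
    Nat.card {m : (k₀ →+* ℂ) → ℕ // ∃ Ψ : CMType K, (cmTypeGaloisSetoid K).r Φ Ψ ∧
        m = fun ψ => {φ : K →+* ℂ | φ ∈ Ψ.1 ∧ φ.comp (algebraMap k₀ K) = ψ}.ncard} =
      finrank ℚ (IntermediateField.adjoin ℚ (Set.range fun a : k₀ => cmTypeTrace Φ (algebraMap k₀ K a))) := by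
  rw [← natCard_subfieldSignature_cmTypeSmul_eq_finrank k₀ Φ]
  refine Nat.card_congr (Equiv.subtypeEquivRight fun m => ⟨?_, ?_⟩)
  · rintro ⟨Ψ, ⟨τ, rfl⟩, rfl⟩
    exact ⟨τ, rfl⟩
  · rintro ⟨τ, rfl⟩
    exact ⟨cmTypeSmul τ Φ, ⟨τ, rfl⟩, rfl⟩

/-- **The number of `k₀`-signatures in the class divides its size `#{τΦ} = [K* : ℚ]`** (`ℚ(tr_Φ(k₀)) ⊆ K*`).
[cite: Dodson1984, §1.1 Remark (p. 5)] [cite: Shimura1998, §8.3 Prop. 28] [cite: MilneFT2022, Prop. 1.20] -/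
theorem natCard_subfieldSignature_cmTypeSmul_dvd_natCard_galoisClass :
    Nat.card {m : (k₀ →+* ℂ) → ℕ // ∃ τ : ℂ ≃+* ℂ,
        m = fun ψ => {φ : K →+* ℂ | φ ∈ (cmTypeSmul τ Φ).1 ∧ φ.comp (algebraMap k₀ K) = ψ}.ncard} ∣
      Nat.card {Ψ : CMType K // ∃ τ : ℂ ≃+* ℂ, Ψ = cmTypeSmul τ Φ} := by
  rw [natCard_subfieldSignature_cmTypeSmul_eq_finrank, natCard_galoisClass_eq_finrank_traceField]
  exact finrank_adjoin_cmTypeTrace_algebraMap_dvd k₀ Φ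

/-- … and is at most that size. [cite: Dodson1984, §1.1 Remark (p. 5)] -/
theorem natCard_subfieldSignature_cmTypeSmul_le_natCard_galoisClass :
    Nat.card {m : (k₀ →+* ℂ) → ℕ // ∃ τ : ℂ ≃+* ℂ,
        m = fun ψ => {φ : K →+* ℂ | φ ∈ (cmTypeSmul τ Φ).1 ∧ φ.comp (algebraMap k₀ K) = ψ}.ncard} ≤
      Nat.card {Ψ : CMType K // ∃ τ : ℂ ≃+* ℂ, Ψ = cmTypeSmul τ Φ} := by
  refine Nat.le_of_dvd ?_ (natCard_subfieldSignature_cmTypeSmul_dvd_natCard_galoisClass k₀ Φ)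
  rw [natCard_galoisClass_eq_finrank_traceField]
  exact finrank_traceField_pos Φ

end Count

/-! ## §3 `k₀` imaginary quadratic: one signature (balanced) or two («`G₀*(f) ∪ G₀*(ρf)`») -/

section ImaginaryQuadratic

variable [IsTotallyComplex k₀] (h2 : finrank ℚ k₀ = 2) (ψ₀ : k₀ →+* ℂ)
include h2

/-- **DODSON: AT MOST TWO SIGNATURES IN A GALOIS CLASS** over an imaginary quadratic `k₀` («the `G`-orbit of `f` is
`G₀*(f) ∪ G₀*(ρf)`»; `ℚ(tr_Φ(k₀)) ⊆ ψ₀(k₀)`). [cite: Dodson1984, §3.1.1 Theorem (proof, p. 12)] -/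
theorem natCard_galoisClass_subfieldSignature_le_two :
    Nat.card {m : (k₀ →+* ℂ) → ℕ // ∃ τ : ℂ ≃+* ℂ,
        m = fun ψ => {φ : K →+* ℂ | φ ∈ Φ.1 ∧ φ.comp (algebraMap k₀ K) = τ⁻¹ • ψ}.ncard} ≤ 2 := by
  obtain ⟨ψ⟩ : Nonempty (k₀ →+* ℂ) := inferInstance
  rw [natCard_galoisClass_subfieldSignature_eq_finrank, ← h2, ← finrank_fieldRange_sd ψ]
  refine Nat.le_of_dvd ?_ (finrank_dvd_of_le_sd (adjoin_cmTypeTrace_algebraMap_le_fieldRange k₀ Φ h2 ψ))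
  rw [finrank_fieldRange_sd, h2]
  exact two_pos

/-- **ONE SIGNATURE IN THE CLASS ⟺ `m_{ψ₀} = m_{ψ̄₀}`** (the balanced / Weil-type case, `ℚ(tr_Φ(k₀)) = ℚ`).
[cite: Dodson1984, §3.1.1 Theorem (proof, p. 12)] [cite: KudlaRapoport2013, §4.1 footnote and §4.4] -/
theorem natCard_galoisClass_subfieldSignature_eq_one_iff :
    Nat.card {m : (k₀ →+* ℂ) → ℕ // ∃ τ : ℂ ≃+* ℂ,
        m = fun ψ => {φ : K →+* ℂ | φ ∈ Φ.1 ∧ φ.comp (algebraMap k₀ K) = τ⁻¹ • ψ}.ncard} = 1 ↔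
      {φ : K →+* ℂ | φ ∈ Φ.1 ∧ φ.comp (algebraMap k₀ K) = ψ₀}.ncard =
        {φ : K →+* ℂ | φ ∈ Φ.1 ∧ φ.comp (algebraMap k₀ K) = ComplexEmbedding.conjugate ψ₀}.ncard := by
  rw [natCard_galoisClass_subfieldSignature_eq_finrank, IntermediateField.finrank_eq_one_iff,
    adjoin_cmTypeTrace_algebraMap_eq_bot_iff_ncard_eq k₀ Φ h2 ψ₀]

/-- **TWO SIGNATURES IN THE CLASS ⟺ `m_{ψ₀} ≠ m_{ψ̄₀}`** (`f` and `ρf`; `ℚ(tr_Φ(k₀)) = ψ₀(k₀)`, Kudla–Rapoport's `E = k`).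
[cite: Dodson1984, §3.1.1 Theorem (proof, p. 12)] [cite: KudlaRapoport2013, §4.4] -/
theorem natCard_galoisClass_subfieldSignature_eq_two_iff :
    Nat.card {m : (k₀ →+* ℂ) → ℕ // ∃ τ : ℂ ≃+* ℂ,
        m = fun ψ => {φ : K →+* ℂ | φ ∈ Φ.1 ∧ φ.comp (algebraMap k₀ K) = τ⁻¹ • ψ}.ncard} = 2 ↔
      {φ : K →+* ℂ | φ ∈ Φ.1 ∧ φ.comp (algebraMap k₀ K) = ψ₀}.ncard ≠
        {φ : K →+* ℂ | φ ∈ Φ.1 ∧ φ.comp (algebraMap k₀ K) = ComplexEmbedding.conjugate ψ₀}.ncard := by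
  constructor
  · intro htwo heq
    have hone := (natCard_galoisClass_subfieldSignature_eq_one_iff k₀ Φ h2 ψ₀).2 heq
    omega
  · intro hne
    rw [natCard_galoisClass_subfieldSignature_eq_finrank]
    exact finrank_adjoin_cmTypeTrace_algebraMap_eq_two_of_ncard_ne k₀ Φ h2 ψ₀ hne

variable [IsCMField K]

/-- `K` CM, `k₀ ⊆ K` imaginary quadratic: **the Galois class of `Φ` shows ONE `k₀`-signature iff `m_{ψ₀} = m_{ψ̄₀}`** …
[cite: Dodson1984, §3.1.1 Theorem (proof, p. 12)] -/
theorem natCard_subfieldSignature_cmTypeSmul_eq_one_iff :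
    Nat.card {m : (k₀ →+* ℂ) → ℕ // ∃ τ : ℂ ≃+* ℂ,
        m = fun ψ => {φ : K →+* ℂ | φ ∈ (cmTypeSmul τ Φ).1 ∧ φ.comp (algebraMap k₀ K) = ψ}.ncard} = 1 ↔
      {φ : K →+* ℂ | φ ∈ Φ.1 ∧ φ.comp (algebraMap k₀ K) = ψ₀}.ncard =
        {φ : K →+* ℂ | φ ∈ Φ.1 ∧ φ.comp (algebraMap k₀ K) = ComplexEmbedding.conjugate ψ₀}.ncard := by
  rw [natCard_subfieldSignature_cmTypeSmul_eq_finrank, ← natCard_galoisClass_subfieldSignature_eq_finrank,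
    natCard_galoisClass_subfieldSignature_eq_one_iff k₀ Φ h2 ψ₀]

/-- … **and TWO (`(a, n−a)` and `(n−a, a)`) iff `m_{ψ₀} ≠ m_{ψ̄₀}`.** [cite: Dodson1984, §3.1.1 Theorem (proof, p. 12)] -/
theorem natCard_subfieldSignature_cmTypeSmul_eq_two_iff :
    Nat.card {m : (k₀ →+* ℂ) → ℕ // ∃ τ : ℂ ≃+* ℂ,
        m = fun ψ => {φ : K →+* ℂ | φ ∈ (cmTypeSmul τ Φ).1 ∧ φ.comp (algebraMap k₀ K) = ψ}.ncard} = 2 ↔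
      {φ : K →+* ℂ | φ ∈ Φ.1 ∧ φ.comp (algebraMap k₀ K) = ψ₀}.ncard ≠
        {φ : K →+* ℂ | φ ∈ Φ.1 ∧ φ.comp (algebraMap k₀ K) = ComplexEmbedding.conjugate ψ₀}.ncard := by
  rw [natCard_subfieldSignature_cmTypeSmul_eq_finrank, ← natCard_galoisClass_subfieldSignature_eq_finrank,
    natCard_galoisClass_subfieldSignature_eq_two_iff k₀ Φ h2 ψ₀]

end ImaginaryQuadratic

end Literature.NumberTheory.ComplexMultiplication
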